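import Literature.IUT.LogVolume.IdealArithmeticDivisors
import Literature.IUT.LogVolume.RArithmeticDivisorsPullback
import Mathlib.NumberTheory.NumberField.Discriminant.Different
import HarnessLib

/-!
# The log-different in a tower `F ⊆ K` of number fields: `log-diff(K) = log-diff(F) + deg(𝔡_{K/F})`

[GenEll] Def. 1.5 (iii) (journal p. 9) defines `log-diff_X(x) := deg_F(δ_x)`, the normalised degree of
the different divisor `δ` of the (minimal) field of definition `F` of `x` (`IdealArithmeticDivisors`:
`differentDivisor`, `logDiff_eq_ndeg_differentDivisor`). Comparing log-differents along a finite map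
`φ : Y → Z` ([GenEll] Prop. 1.7 (i), proof p. 11: "follows immediately from the elementary theory of
differents") or along the tower `F_mod ⊆ F_tpd ⊆ F ⊆ K` of [IUTchIV] Thm. 1.10 (Steps (ii), (iii),
(viii); the fields `F_le`, `K_le`, `tpd_le_F` of the tree's `Thm110Numerics.ProofData`) rests on ONE
classical identity — the transitivity of the different, `𝔡_{K/ℚ} = 𝔡_{K/F} · 𝔡_{F/ℚ}O_K`, i.e.
`|d_K| = N(𝔡_{K/F}) · |d_F|^{[K:F]}` (Mathlib
`NumberField.natAbs_discr_eq_absNorm_differentIdeal_mul_natAbs_discr_pow`). In the divisor vocabulary of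
this directory ([IUTchIV] Def. 1.9 `ADivisor`, `ndeg`):

* `relDifferentDivisor F K = Σ_w ord_w(𝔡_{K/F})·w ∈ ADiv_ℝ(K)` (effective, `ofIdeal` of Mathlib's
  `differentIdeal (𝓞 F) (𝓞 K)`), `relDifferentIdeal_ne_bot`;
* **`ndeg_differentDivisor_tower : deg(δ_K) = deg(δ_F) + deg(𝔡_{K/F})`** (normalised degrees; the
  unnormalised form `degF_differentDivisor_tower : deg_K(δ_K) = [K:F]·deg_F(δ_F) + deg_K(𝔡_{K/F})`);
* `ndeg_differentDivisor_mono : deg(δ_F) ≤ deg(δ_K)` ("the portion … of `log-diff_Y − log-diff_Z` is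
  `≥ 0` [again by the elementary theory of differents]", [GenEll] p. 11).
Classical (Dedekind's different); no statement of the disputed corpus is involved.
[cite: MochizukiGenEll2010, Prop. 1.7 (i) p.11]
-/

noncomputable section

namespace Literature.IUT.LogVolume

open NumberField IsDedekindDomain Finset

variable (F K : Type*) [Field F] [NumberField F] [Field K] [NumberField K] [Algebra F K]

/-- **`𝔡_{K/F}` as an effective arithmetic divisor on `K`**: `Σ_w ord_w(𝔡_{K/F})·w`.
[cite: MochizukiGenEll2010, Prop. 1.7 (i) p.11] -/
def relDifferentDivisor : ADivisor K := ADivisor.ofIdeal (differentIdeal (𝓞 F) (𝓞 K))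

/-- **Transitivity of the different, discriminant form** (Mathlib): `|d_K| = N(𝔡_{K/F})·|d_F|^{[K:F]}`.
[cite: MochizukiGenEll2010, Prop. 1.7 (i) p.11] -/
theorem natAbs_discr_eq : (discr K).natAbs =
    Ideal.absNorm (differentIdeal (𝓞 F) (𝓞 K)) * (discr F).natAbs ^ Module.finrank F K :=
  natAbs_discr_eq_absNorm_differentIdeal_mul_natAbs_discr_pow F (𝓞 F) K (𝓞 K)

/-- The relative different `𝔡_{K/F}` is a nonzero ideal (its norm divides `d_K ≠ 0`).
[cite: MochizukiGenEll2010, Prop. 1.7 (i) p.11] -/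
theorem relDifferentIdeal_ne_bot : differentIdeal (𝓞 F) (𝓞 K) ≠ ⊥ := by
  intro h
  have h2 := natAbs_discr_eq F K
  rw [h, Ideal.absNorm_bot, zero_mul] at h2
  exact (Int.natAbs_ne_zero.mpr (discr_ne_zero K)) h2

omit [NumberField F] in
/-- `𝔡_{K/F}` as a divisor is effective. [cite: MochizukiGenEll2010, Prop. 1.7 (i) p.11] -/
theorem relDifferentDivisor_isEffective : (relDifferentDivisor F K).IsEffective :=
  ADivisor.ofIdeal_isEffective _

/-- `deg_K(𝔡_{K/F}) = log N(𝔡_{K/F}) ≥ 0`. [cite: MochizukiGenEll2010, Prop. 1.7 (i) p.11] -/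
theorem degF_relDifferentDivisor :
    degF K (relDifferentDivisor F K) = Real.log (Ideal.absNorm (differentIdeal (𝓞 F) (𝓞 K))) :=
  degF_ofIdeal K (relDifferentIdeal_ne_bot F K)

/-- **`deg_K(δ_K) = [K:F]·deg_F(δ_F) + deg_K(𝔡_{K/F})`** (log of the discriminant tower formula).
[cite: MochizukiGenEll2010, Prop. 1.7 (i) p.11] -/
theorem degF_differentDivisor_tower :
    degF K (differentDivisor K) =
      Module.finrank F K * degF F (differentDivisor F) + degF K (relDifferentDivisor F K) := by
  have hdK : ((discr K).natAbs : ℝ) ≠ 0 := by exact_mod_cast Int.natAbs_ne_zero.mpr (discr_ne_zero K)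
  have hdF : ((discr F).natAbs : ℝ) ≠ 0 := by exact_mod_cast Int.natAbs_ne_zero.mpr (discr_ne_zero F)
  have hN : (Ideal.absNorm (differentIdeal (𝓞 F) (𝓞 K)) : ℝ) ≠ 0 := by
    exact_mod_cast Ideal.absNorm_eq_zero_iff.not.mpr (relDifferentIdeal_ne_bot F K)
  rw [degF_differentDivisor, degF_differentDivisor, degF_relDifferentDivisor]
  have h := congrArg (fun n : ℕ => Real.log (n : ℝ)) (natAbs_discr_eq F K)
  simp only [Nat.cast_mul, Nat.cast_pow] at h
  rw [h, Real.log_mul hN (pow_ne_zero _ hdF), Real.log_pow]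
  ring

/-- **The log-different in a tower**: `deg(δ_K) = deg(δ_F) + deg(𝔡_{K/F})` for the normalised degrees,
i.e. `log-diff(K) = log-diff(F) + (1/[K:ℚ])·log N(𝔡_{K/F})` — the "elementary theory of differents"
behind [GenEll] Prop. 1.7 (i) and [IUTchIV] Thm. 1.10 Steps (ii)–(iii).
[cite: MochizukiGenEll2010, Prop. 1.7 (i) p.11] -/
theorem ndeg_differentDivisor_tower :
    ndeg K (differentDivisor K) = ndeg F (differentDivisor F) + ndeg K (relDifferentDivisor F K) := by
  have hF : (0 : ℝ) < Module.finrank ℚ F := by exact_mod_cast Module.finrank_pos (R := ℚ) (M := F)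
  have hKF : (0 : ℝ) < Module.finrank F K := by exact_mod_cast Module.finrank_pos (R := F) (M := K)
  rw [ndeg_apply, ndeg_apply, ndeg_apply, degF_differentDivisor_tower F K, finrank_rat_eq_mul (F := F) (K := K)]
  field_simp

/-- **Monotonicity**: `deg(δ_F) ≤ deg(δ_K)` for `F ⊆ K` (the relative different divisor is effective).
[cite: MochizukiGenEll2010, Prop. 1.7 (i) p.11] -/
theorem ndeg_differentDivisor_mono : ndeg F (differentDivisor F) ≤ ndeg K (differentDivisor K) := by
  rw [ndeg_differentDivisor_tower F K]
  exact le_add_of_nonneg_right (ndeg_nonneg K (relDifferentDivisor_isEffective F K))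

/-- The defect `deg(δ_K) − deg(δ_F) = (1/[K:ℚ])·log N(𝔡_{K/F})` explicitly.
[cite: MochizukiGenEll2010, Prop. 1.7 (i) p.11] -/
theorem ndeg_differentDivisor_sub :
    ndeg K (differentDivisor K) - ndeg F (differentDivisor F) =
      Real.log (Ideal.absNorm (differentIdeal (𝓞 F) (𝓞 K))) / Module.finrank ℚ K := by
  rw [ndeg_differentDivisor_tower F K, add_sub_cancel_left, ndeg_apply, degF_relDifferentDivisor]

end Literature.IUT.LogVolume

end
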